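import Literature.AlgebraicGeometry.Resolution.BlowupSequencesAppend
import HarnessLib

/-!
# Deleting empty blow-ups from a concatenation (Kollár 2007, 3.32 / 3.34.1)

Topic: `Literature/AlgebraicGeometry/Resolution`. Shared infrastructure for the decomposition of
the named facts `Kollar2007Thm3_103` / `Kollar2007Thm3_107` (`KollarBlowupSequenceFunctors.lean`;
J. Kollár, *Lectures on Resolution of Singularities*, 2007, Ch. 3), continuing
`BlowupSequencesAppend.lean`. The functoriality package 3.34.1 compares the value of a blow-up
sequence functor on a pulled-back triple with the pull-back of its value AFTER DELETING THE
EMPTY BLOW-UPS (`CentreSeq.prune`, `KollarBlowupSequenceFunctors.lean`: "obtained from the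
pull-back `h^*𝓑(X, I, E)` by deleting every blow-up `h^*π_i` whose center is empty and
reindexing"). For functors built by concatenation (3.104, 3.111) one therefore needs to know how
pruning interacts with concatenation; since deleting an empty blow-up `Bl_∅ X_i ≅ X_i` moves the
rest of the sequence down along that isomorphism, the second part of a concatenation has to be
transported along the resulting identification of the last schemes. This file provides:

* `CentreSeq.pruneι s : s.prune.top ⟶ s.top` — **the canonical identification of the last scheme
  of the pruned sequence with the last scheme of `s`** (DEFINITION, by the same recursion as
  `prune`: the identity, or the comparison morphism `comapι` along `(Bl_∅ X → X)⁻¹` followed by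
  the identification for the rest); `pruneι_comp` (it lies over `X`), `isIso_pruneι`;
* `isExtensionOf_append_prune` — if `t`, moved to `s.prune.top`, is an extension of `t'`
  (BGMW Def. 3.1.5, `CentreSeq.IsExtensionOf`), then `s ⧺ t` is an extension of `s.prune ⧺ t'`;
* **`prune_append`: `(s ⧺ t).prune = s.prune ⧺ (pruneι^* t).prune`** — deleting the empty
  blow-ups of a concatenation deletes those of each part (through the uniqueness of the pruning
  as the sequence without empty blow-ups of which `s ⧺ t` is an extension,
  `IsExtensionOf.prune_eq`).

All comparisons of morphisms between last schemes are made with the rigidity lemma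
`CentreSeq.hom_ext_of_flat` / `eq_id_of_comp_eq` of `BlowupSequencesAppend.lean` (a flat
endomorphism of `X_r` over `X` is the identity), which replaces coherence bookkeeping for the
`eqToHom`s and comparison morphisms involved.

## Sources

* J. Kollár, *Lectures on Resolution of Singularities* (2007): 3.32 (empty blow-up convention),
  3.34.1 (deleting empty blow-ups and reindexing), 3.109–3.111. [Kollar2007]
* E. Bierstone, D. Grigoriev, P. Milman, J. Włodarczyk, arXiv:1206.3090, Def. 3.1.5
  (extensions). [BierstoneGrigorievMilmanWlodarczyk2011]
-/

noncomputable section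

open CategoryTheory CategoryTheory.Limits AlgebraicGeometry TopologicalSpace

namespace Literature.AlgebraicGeometry.Resolution

universe u

namespace CentreSeq

variable {X U : Scheme.{u}}

/-! ## The identification `s.prune.top ⟶ s.top` -/

/-- A blow-up along the unit ideal sheaf (empty centre) is an isomorphism. [folklore] -/
theorem isIso_blowup_π_of_eq_top {C : X.IdealSheafData} (hC : C = ⊤) : IsIso (blowup.π C) := by
  subst hC
  infer_instance

/-- Unfolding `prune` at an empty first blow-up given by an equation `C = ⊤`. [folklore] -/
theorem prune_cons_of_eq_top {C : X.IdealSheafData} (hC : C = ⊤) (rest : CentreSeq (blowup C)) :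
    (cons C rest).prune =
      haveI := isIso_blowup_π_of_eq_top hC
      rest.prune.comap (inv (blowup.π C)) := by
  subst hC
  exact prune_cons_top rest

/-- Pulling back along `eqToHom e` and back again (the other orientation of
`comap_eqToHom_comap_eqToHom_symm`). [folklore] -/
theorem comap_eqToHom_symm_comap_eqToHom {Y Z : Scheme.{u}} (e : Y = Z) (t : CentreSeq Z) :
    (t.comap (eqToHom e)).comap (eqToHom e.symm) = t := by
  subst e
  simp

open Classical in
/-- **The identification of the last scheme of the pruned sequence with the last scheme of the
sequence** (Kollár 3.34.1, "deleting every blow-up whose center is empty and reindexing": an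
empty blow-up `Bl_∅(X_i) → X_i` is an isomorphism and the later blow-ups are moved down along
it): the identity for the empty sequence; for a first blow-up with centre `C ≠ ∅` the
identification for the rest; for an empty first blow-up the comparison morphism of the
transported rest (`comapι` along `(Bl_∅ X → X)⁻¹`) followed by the identification for the rest.
[cite: Kollar2007, 3.34.1 (p. 131)] -/
def pruneι : {X : Scheme.{u}} → (s : CentreSeq X) → (s.prune.top ⟶ s.top)
  | _, nil X => 𝟙 X
  | _, cons C rest =>
    if hC : C = ⊤ then
      haveI := isIso_blowup_π_of_eq_top hC
      eqToHom (congrArg top (prune_cons_of_eq_top hC rest)) ≫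
        rest.prune.comapι (inv (blowup.π C)) ≫ pruneι rest
    else
      eqToHom (congrArg top (prune_cons_of_ne_top hC rest)) ≫ pruneι rest

/-- Unfolding. [folklore] -/
@[simp] theorem pruneι_nil (X : Scheme.{u}) : (nil X).pruneι = 𝟙 X := rfl

/-- Unfolding at a non-empty first blow-up. [folklore] -/
theorem pruneι_cons_of_ne_top {C : X.IdealSheafData} (hC : C ≠ ⊤) (rest : CentreSeq (blowup C)) :
    (cons C rest).pruneι = eqToHom (congrArg top (prune_cons_of_ne_top hC rest)) ≫ rest.pruneι := by
  rw [pruneι, dif_neg hC]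
  rfl

/-- Unfolding at an empty first blow-up. [folklore] -/
theorem pruneι_cons_of_eq_top {C : X.IdealSheafData} (hC : C = ⊤) (rest : CentreSeq (blowup C)) :
    (cons C rest).pruneι =
      haveI := isIso_blowup_π_of_eq_top hC
      eqToHom (congrArg top (prune_cons_of_eq_top hC rest)) ≫
        rest.prune.comapι (inv (blowup.π C)) ≫ rest.pruneι := by
  rw [pruneι, dif_pos hC]
  rfl

/-- **The identification lies over `X`**: `pruneι ≫ (X_r → X) = (s.prune)_top → X`.
[cite: Kollar2007, 3.34.1 (p. 131)] -/
theorem pruneι_comp : ∀ {X : Scheme.{u}} (s : CentreSeq X), s.pruneι ≫ s.comp = s.prune.comp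
  | _, nil X => show 𝟙 X ≫ 𝟙 X = 𝟙 X by simp
  | _, cons C rest => by
    by_cases hC : C = ⊤
    · haveI := isIso_blowup_π_of_eq_top hC
      rw [pruneι_cons_of_eq_top hC, ← eqToHom_comp_comp (prune_cons_of_eq_top hC rest)]
      show (eqToHom _ ≫ rest.prune.comapι (inv (blowup.π C)) ≫ rest.pruneι) ≫ rest.comp ≫
          blowup.π C = eqToHom _ ≫ (rest.prune.comap (inv (blowup.π C))).comp
      simp only [Category.assoc]
      rw [reassoc_of% (pruneι_comp rest),
        ← reassoc_of% (comap_comp_ι rest.prune (inv (blowup.π C))), IsIso.inv_hom_id,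
        Category.comp_id]
    · rw [pruneι_cons_of_ne_top hC, ← eqToHom_comp_comp (prune_cons_of_ne_top hC rest)]
      show (eqToHom _ ≫ rest.pruneι) ≫ rest.comp ≫ blowup.π C =
        eqToHom _ ≫ rest.prune.comp ≫ blowup.π C
      simp only [Category.assoc]
      rw [reassoc_of% (pruneι_comp rest)]

/-- **The identification is an isomorphism** (a composite of identities, `eqToHom`s and flat base
changes of the isomorphisms `Bl_∅ → X`). [cite: Kollar2007, 3.34.1 (p. 131)] -/
theorem isIso_pruneι : ∀ {X : Scheme.{u}} (s : CentreSeq X), IsIso s.pruneι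
  | _, nil X => show IsIso (𝟙 X) from inferInstance
  | _, cons C rest => by
    haveI := isIso_pruneι rest
    by_cases hC : C = ⊤
    · haveI := isIso_blowup_π_of_eq_top hC
      haveI : IsIso (rest.prune.comapι (inv (blowup.π C))) :=
        comapι_mem (MorphismProperty.isomorphisms Scheme.{u})
          (fun g (hg : IsIso g) => inferInstance) rest.prune (inv (blowup.π C))
          (inferInstance : IsIso (inv (blowup.π C)))
      rw [pruneι_cons_of_eq_top hC]
      dsimp only [top_cons]
      infer_instance
    · rw [pruneι_cons_of_ne_top hC]
      dsimp only [top_cons]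
      infer_instance

/-- The identification `s.prune.top ⟶ s.top` is an isomorphism (instance form of
`isIso_pruneι`). [cite: Kollar2007, 3.34.1 (p. 131)] -/
instance instIsIsoPruneι (s : CentreSeq X) : IsIso s.pruneι := isIso_pruneι s

/-! ## Pruning a concatenation -/

/-- If `t`, pulled back to the last scheme of `s.prune`, is an extension of `t'`, then `s ⧺ t` is
an extension of `s.prune ⧺ t'` (induction on `s`: a non-empty first blow-up is matched, an empty
one is deleted and the rest compared after pulling back along `Bl_∅ X → X`, BGMW Def. 3.1.5).
[cite: BierstoneGrigorievMilmanWlodarczyk2011, Def. 3.1.5] -/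
theorem isExtensionOf_append_prune : ∀ {X : Scheme.{u}} (s : CentreSeq X) (t : CentreSeq s.top)
    (t' : CentreSeq s.prune.top),
    (t.comap s.pruneι).IsExtensionOf t' → (s.append t).IsExtensionOf (s.prune.append t')
  | _, nil X, t, t', h => by
    change (t.comap (𝟙 _)).IsExtensionOf t' at h
    rw [comap_id] at h
    exact h
  | _, cons C rest, t, t', h => by
    dsimp only [top_cons] at t h
    by_cases hC : C = ⊤
    · -- an empty first blow-up: it is deleted by `prune` (no `subst`: structural recursion)
      haveI := isIso_blowup_π_of_eq_top hC
      have e := prune_cons_of_eq_top hC rest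
      set u : CentreSeq (rest.prune.comap (inv (blowup.π C))).top :=
        t'.comap (eqToHom (congrArg top e).symm) with hu_def
      have hu : t' = u.comap (eqToHom (congrArg top e)) :=
        (comap_eqToHom_comap_eqToHom_symm (congrArg top e) t').symm
      rw [hu, append_congr e]
      refine Or.inr ⟨hC, ?_⟩
      rw [comap_append]
      have e₂ : (rest.prune.comap (inv (blowup.π C))).comap (blowup.π C) = rest.prune :=
        comap_comap_of_comp_eq_id (IsIso.hom_inv_id (blowup.π C)) rest.prune
      set w := u.comap ((rest.prune.comap (inv (blowup.π C))).comapι (blowup.π C)) with hw_def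
      set v : CentreSeq rest.prune.top := w.comap (eqToHom (congrArg top e₂).symm) with hv_def
      have hw : w = v.comap (eqToHom (congrArg top e₂)) :=
        (comap_eqToHom_comap_eqToHom_symm (congrArg top e₂) w).symm
      rw [hw, append_congr e₂]
      refine isExtensionOf_append_prune rest t v ?_
      -- move the hypothesis along the same identifications
      rw [pruneι_cons_of_eq_top hC, comap_comp, comap_comp] at h
      have h₃ := ((h.comap (eqToHom (congrArg top e).symm)).comap
        ((rest.prune.comap (inv (blowup.π C))).comapι (blowup.π C))).comap
        (eqToHom (congrArg top e₂).symm)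
      rw [comap_eqToHom_symm_comap_eqToHom] at h₃
      rw [← comap_comp, ← comap_comp] at h₃
      have hφ : (eqToHom (congrArg top e₂).symm ≫
          (rest.prune.comap (inv (blowup.π C))).comapι (blowup.π C) ≫
            rest.prune.comapι (inv (blowup.π C))) = 𝟙 _ := by
        haveI : Flat ((rest.prune.comap (inv (blowup.π C))).comapι (blowup.π C)) :=
          flat_comapι _ _
        haveI : Flat (rest.prune.comapι (inv (blowup.π C))) := flat_comapι _ _
        refine rest.prune.eq_id_of_comp_eq ?_
        simp only [Category.assoc]
        rw [← comap_comp_ι rest.prune (inv (blowup.π C)),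
          ← reassoc_of% (comap_comp_ι (rest.prune.comap (inv (blowup.π C))) (blowup.π C)),
          IsIso.hom_inv_id, Category.comp_id, ← eqToHom_comp_comp e₂.symm]
      simp only [Category.assoc] at h₃
      rw [hφ, comap_id] at h₃
      exact h₃
    · -- a non-empty first blow-up: it is kept by `prune`
      have e := prune_cons_of_ne_top hC rest
      set u : CentreSeq (cons C rest.prune).top := t'.comap (eqToHom (congrArg top e).symm)
        with hu_def
      have hu : t' = u.comap (eqToHom (congrArg top e)) :=
        (comap_eqToHom_comap_eqToHom_symm (congrArg top e) t').symm
      rw [hu, append_congr e]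
      refine IsExtensionOf.cons_cons (isExtensionOf_append_prune rest t u ?_)
      rw [pruneι_cons_of_ne_top hC, comap_comp] at h
      have h₁ := h.comap (eqToHom (congrArg top e).symm)
      rw [comap_eqToHom_symm_comap_eqToHom] at h₁
      exact h₁

/-- **Pruning a concatenation**: deleting the empty blow-ups of `s ⧺ t` deletes those of `s` and
then those of `t` moved to the last scheme of `s.prune` (Kollár 3.34.1 applied to a functor
defined by "continuing on `X_r`", 3.104 / 3.111). [cite: Kollar2007, 3.34.1 (p. 131)] -/
theorem prune_append (s : CentreSeq X) (t : CentreSeq s.top) :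
    (s.append t).prune = s.prune.append ((t.comap s.pruneι).prune) :=
  (isExtensionOf_append_prune s t _ (isExtensionOf_prune _)).prune_eq
    ((noEmptyCentres_append_iff _ _).mpr ⟨noEmptyCentres_prune s, noEmptyCentres_prune _⟩)

/-- In particular, if neither `s` nor `t` contains an empty blow-up then neither does `s ⧺ t`,
and pruning does nothing. [folklore] -/
theorem prune_append_of_noEmptyCentres {s : CentreSeq X} {t : CentreSeq s.top}
    (hs : s.NoEmptyCentres) (ht : t.NoEmptyCentres) : (s.append t).prune = s.append t :=
  prune_eq_self_of_noEmptyCentres _ ((noEmptyCentres_append_iff s t).mpr ⟨hs, ht⟩)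

end CentreSeq

end Literature.AlgebraicGeometry.Resolution

end
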